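import Literature.NumberTheory.EllipticCurves.CastellaGrossiSkinner2025.PerrinRiouMainConjectureProofs
import Literature.NumberTheory.EllipticCurves.YanZhu2026.PerrinRiouCyclotomicRestriction
import HarnessLib

/-!
# Castella–Grossi–Skinner 2025, Thm. 7.2.3 IN ITS LITERAL PRINTED FORM —
# `ch_{Λ_K⁺}(𝔛_ord(E/K_∞⁺)) = (𝓛_p^PR(E/K)⁺)` with `𝓛_p^PR(E/K)` NAMED (the Hida–Perrin-Riou carrier
# `perrinRiouLFunction`, `IsHidaRankinLFunction`) — PROVED from the tree's named facts Thm. 7.2.3 (read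
# through Prop. 2.2.4) and Prop. 2.2.4 at print strength (= Yan–Zhu 2026 Prop. 3.7); theorems only

HONEST FRAMING (cell `bsd-littype` = BSD share of the cross-ladder LITERATURE-TYPING layer, D-0088(4);
seat `bsd-littype-02`, gen 6; run/shared/lean/pub/bsd-littype/): typed ≠ proved ≠ endorsed; no tranche
here proves BSD. This file introduces NO definition and NO named fact (0 new debt): every declaration is a
`theorem` over Mathlib, tree theorems and the EXISTING named facts taken as explicit hypotheses —
`thm723_charIdeal_eq_padicLFunction_mul` (printed Thm. 7.2.3, right-hand side read through Prop. 2.2.4;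
`PerrinRiouMainConjecture.lean`, gen 2), `YanZhu2026.prop37_cycRestrict_perrinRiou_eq_padicLFunction_mul`
(Yan–Zhu 2026 Prop. 3.7 AT PRINT STRENGTH, printed proof "See [CGS, Proposition 2.2.4]"; seat
`bsd-littype-04` gen 6), `nonempty_modularParametrizationData` for the twist's newform (BCDT, as in the
sibling's `thmA_of_thm723`); optionally Theorem A (A142) + Prop. 3.3.1 in place of Thm. 7.2.3.

WHY (gen-2 transcription item 5 of `PerrinRiouMainConjecture.lean`; HOME/INBOX l.118, `bsd-littype-04` g6:
"an edge thm723 ↔ YZ two-variable objects on the cyclotomic line is typable"): when Thm. 7.2.3 was typed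
(2026-08-26) the tree had no NAME for the two-variable `𝓛_p^PR(E/K)`, so `(𝓛_p^PR(E/K)⁺)` was READ
THROUGH Prop. 2.2.4 as the ideal of `ϖϖ' · L_p(f, α) · L_p(g, α')`. Since then the refereed Yan–Zhu 2026
carrier landed (`IsHidaRankinLFunction ι W κ₁ κ₂ f F` = Hida's `𝓛_p^I(f/K)` = [CGS, Thm. 2.2.3]
`𝓛_p(f/K, Σ^{(1)})`; `perrinRiouLFunction W π F = (1 − p/α²)(1 − 1/α²) · deg(π_E)/c_E² · F` = Yan–Zhu
Def. 3.4 = VERBATIM [CGS, Def. 2.2.2], `H_p(f) = (1 − p/α_p²)(1 − 1/α_p²)`, final TeX l.786–788,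
l.821–826), `Λ_K → Λ_K⁺` became `cycRestrict` (`IwasawaAlgebra₂.cycRestrict_toCycAnti`), and Prop. 2.2.4
landed at print strength (p501357). So the LITERAL display is statable in tree vocabulary, and this file
PROVES it from the two named facts: every dual datum `D` of `𝔛_ord(E/K_∞⁺) = Sel_{p^∞}(E/K_∞⁺)^∨` is
torsion and, for every `F` in Hida's frame, `char_Λ D = (G)` with `ι G = cycRestrict (perrinRiouLFunction W
π F)` (the unit of Prop. 2.2.4 absorbed into the generator). The conclusion has EXACTLY the shape of the
cyclotomic clause of the OPEN binder `BurungaleSkinnerTianWan2024.thm1010b_standardMainStatement_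
oneVariable_OPEN` (seat `bsd-littype-01`; an UNREFEREED claim on the (irr_ℚ) ∧ ((def) ∨ (indef)) locus),
so the cells consuming that shape (K3 literal row D1, `bsd-cn100`, X9/X11b) can cite, on the complementary
EISENSTEIN locus, a REFEREED theorem by name. Conversely (§4, pointwise, pure algebra) the literal display
and Prop. 2.2.4 give back the product display — the two readings carry the same content datum by datum.

## Citation header (final TeX of the accepted version = arXiv:2303.04373v2 = Math. Ann. 393 (2025),
`run/shared/lean/b2b/bsd-rank1-residual/b2b-bsdres-lit-cgls/src/cgs25-final/Mazur-paper_revised.tex`;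
arXiv v1 numbers, = the store's LaTeXML text `paper:arxiv-2303.04373`, second)

* **Theorem 7.2.3** (`thm:PR-IMC`, l.3422–3431; v1 Thm. 6.1.3, `[corpus: paper:arxiv-2303.04373
  p0028:L40–L48]`), verbatim: "Let `E/ℚ` be an elliptic curve, and `p > 2` a prime of good reduction for
  `E` such that `E[p]^{ss} = 𝔽_p(φ) ⊕ 𝔽_p(ψ)` with `φ|_{G_{ℚ_p}} ≠ 1, ω`. Then [the] module `𝔛_ord(E/K_∞⁺)`
  is `Λ_K⁺`-torsion, with `ch_{Λ_K⁺}(𝔛_ord(E/K_∞⁺)) = (𝓛_p^PR(E/K)⁺)`." (l.3420: "We are now in a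
  position to prove Conjecture 3.2.2 for `𝔛_ord(E/K_∞⁺)`"; `K` chosen at l.3288 with (Heeg), (spl), (disc).)
* **Definition 2.2.2** (`def:PR`, l.821–826; v1 Def. 1.2.2): "`𝓛_p^PR(E/K) := (deg(π_E)/c_E²) · H_p(f) ·
  𝓛_p(f/K, Σ^{(1)})`, where `c_E` is the Manin constant associated to `π_E`"; `H_p(f) = (1 − p/α_p²)
  (1 − 1/α_p²)` (l.786–788); `𝓛_p(f/K, Σ^{(1)}) ∈ c_f⁻¹Λ_K` Hida's function of Thm. 2.2.3 (`thm:PR`,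
  l.794–808). l.847: "Denote by `𝓛_p^PR(E/K)⁺ ∈ Λ_ℚ` the image of `𝓛_p^PR(E/K)` under the map induced by
  the projection `Γ_K ↠ Γ_K⁺ ≃ Γ_ℚ`."
* **Proposition 2.2.4** (`prop:comp-Lcyc`, l.849–856; v1 Prop. 1.2.4): "Up to a unit in `Λ_ℚ^×`, we have
  `𝓛_p^PR(E/K)⁺ = 𝓛_p^MSD(E/ℚ) · 𝓛_p^MSD(E^K/ℚ)`" — tree: `YanZhu2026.prop37_cycRestrict_perrinRiou_eq_
  padicLFunction_mul` (Yan–Zhu, J. Algebra 693 (2026), Prop. 3.7, arXiv:2412.20078v4 TeX l.821–829, proof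
  "See [CGS, Proposition 2.2.4]"; Yan–Zhu Thm. 3.3 / Def. 3.4, l.743–763, = [CGS] Thm. 2.2.3 / Def. 2.2.2).
* **Conjecture 3.2.2** (Greenberg; `conj:IMC-K`, l.1187–1194), first line — the statement Thm. 7.2.3
  proves; documented, not filed (conjecture leaves live under `Summits/`).

## Transcription of the literal display (tree vocabulary only; binder for binder)

* `(E, p)`: VERBATIM Theorem A / Thm. 7.2.3 as typed — `W` globally minimal, `2 < p`, `Good W p`,
  `Red W p`, `¬ Anom W p`; `K`: `IsImaginaryQuadratic K`, (Heeg) for `N_E = W.conductorNorm ℤ`, (disc)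
  `Odd d_K ∧ d_K ≠ −3`, (spl) `#primesOver p = 2`.
* `K_∞⁺`, `Λ_K`, `Λ_K⁺`: as in every two-variable statement of the tree (Yan–Zhu files, BSTW24 binders) —
  THE cyclotomic/anticyclotomic pair `(κ₁, κ₂)` of `ℤ_p`-extensions of `K` (`κ₁.IsCyclotomic`,
  `κ₂.IsAnticyclotomic`) with an adapted generator pair `(γ₁, γ₂)` (`Fact (ZpExtension.IsTopGeneratorPair
  κ₁ κ₂ γ₁ γ₂)`), `Λ_K = ℤ_p⟦T₂⟧⟦T₁⟧ ↪ ℚ_p⟦T⟧⟦S⟧` (`CycAntiSeries p`), `Λ_K → Λ_K⁺` = `cycRestrict`; the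
  generator `γ₁` NORMALISED to the cyclotomic variable of the one-variable functions,
  `IsCyclotomicVariable p (absGaloisRestrict ℚ K γ₁)` — which IS the `K`-side normalisation
  "`χ_p(γ₁) · ζ = γ_cyc`" of the gen-2 facts (`isCyclotomicVariable_absGaloisRestrict_iff`, §2: `χ_p`
  commutes with restriction). Special case on the generator axis, exactly as `thm723_…` and `prop37_…`
  themselves (a change-of-generator transport for the two-variable frame is not in the tree:
  OPEN-QUESTIONS-04 Q25 (a)); the printed statement is generator-free.
* `𝔛_ord(E/K_∞⁺)`: EVERY `D : (W.baseChange K).SelmerDualData κ₁ γ₁` (gen-2 item 4; = the object of the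
  BSTW24 one-variable binder).
* `𝓛_p^PR(E/K)`: `perrinRiouLFunction W π F` for `π : ModularParametrizationData W N` a modular
  parametrisation at the conductor (`(N : ℤ) = W.conductorNorm ℤ`, the `level` field of
  `BurungaleSkinnerTianWan2024.Thm1010bHypotheses`) and EVERY `F` with `IsHidaRankinLFunction ι
  W κ₁ κ₂ π.f F` (every embedding datum `ι`); `(𝓛_p^PR(E/K)⁺) = ch` ↦ `∃ G : Λ, D.charIdeal = Ideal.span
  {G} ∧ ι G = cycRestrict (perrinRiouLFunction W π F)`, `ι = iwasawaToPowerSeries p`.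

FAITHFULNESS: literal display FAITHFUL (both clauses, torsion and equality); hypotheses complete and
never weaker than print; WEAKER than print only on the generator axis (normalised `γ₁`), as recorded.
Nothing is asserted: every theorem is conditional on the named facts it lists. §5 (rev 2): the
(disc)-clause `d_K ≠ −3` of §7.2's `K` is REMOVABLE in the kernel (both displays) via Theorem A +
Prop. 3.3.1 — a consequence of the paper's Theorem A, not a statement printed in the paper.

## References
* [CastellaGrossiSkinner2025] Math. Ann. **393** (2025) 2451–2506 = arXiv:2303.04373v2: Thm. 7.2.3
  (l.3422–3431), Def. 2.2.2 (l.821–826), l.847, Prop. 2.2.4 (l.849–856), Thm. 2.2.3 (l.794–808),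
  Conj. 3.2.2 (l.1187–1194), §7.2 "Proof of Theorem A" (l.3450–3462).
* [YanZhu2024MainConjNonCM] J. Algebra **693** (2026) = arXiv:2412.20078v4: Thm. 3.3, Def. 3.4
  (l.743–763), Prop. 3.7 (l.821–829).
* [BCDTJAMS2001] J. Amer. Math. Soc. 14 (2001), Thm. A (tree fact `nonempty_modularParametrizationData`).
* [Washington1997] GTM 83, §13.1 (cyclotomic `ℤ_p`-extension; `χ_p` under restriction).
* pub/bsd-littype/staging/bsd-littype-02/SHEETS-02.md (gen-6 addendum); HOME/INBOX.md l.118.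
-/

noncomputable section

open scoped Classical MatrixGroups ModularForm
open CongruenceSubgroup WeierstrassCurve NumberField Field Literature.NumberTheory.EllipticCurves
  Literature.NumberTheory.EllipticCurves.ModularForms Literature.NumberTheory.EllipticCurves.Rank1Residual
  Literature.NumberTheory.GaloisRepresentations

namespace Literature.NumberTheory.EllipticCurves.CastellaGrossiSkinner2025

/-! ### 1. Pure algebra: "up to a unit in `Λ^×`" — absorbing a unit into the generator -/

/-- **Absorbing a unit into a generator** (the algebra of "up to a unit in `Λ_ℚ^×`", Prop. 2.2.4): if
`I = (G)` with `φ G = A` and `B = φ u · A` for a unit `u`, then `I = (G')` with `φ G' = B` (`G' = u G`).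
[cite: CastellaGrossiSkinner2025, Prop. 2.2.4 ("Up to a unit in Λ_ℚ^×", final TeX l.849–856) — the algebra of the unit] -/
theorem exists_eq_span_and_map_eq_of_eq_map_unit_mul {R S : Type*} [CommRing R] [Semiring S]
    (φ : R →+* S) {I : Ideal R} {G : R} {A B : S} (hI : I = Ideal.span {G}) (hG : φ G = A) (u : Rˣ)
    (hB : B = φ u * A) : ∃ G' : R, I = Ideal.span {G'} ∧ φ G' = B :=
  ⟨u * G, by rw [hI, Ideal.span_singleton_mul_left_unit u.isUnit], by rw [map_mul, hG, hB]⟩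

/-- **Removing a unit from a generator** (the same algebra, read backwards): if `I = (G)` with
`φ G = φ u · A` for a unit `u`, then `I = (G')` with `φ G' = A` (`G' = u⁻¹ G`).
[cite: CastellaGrossiSkinner2025, Prop. 2.2.4 ("Up to a unit in Λ_ℚ^×", final TeX l.849–856) — the algebra of the unit] -/
theorem exists_eq_span_and_map_eq_of_map_eq_unit_mul {R S : Type*} [CommRing R] [Semiring S]
    (φ : R →+* S) {I : Ideal R} {G : R} {A : S} (hI : I = Ideal.span {G}) (u : Rˣ)
    (hG : φ G = φ u * A) : ∃ G' : R, I = Ideal.span {G'} ∧ φ G' = A :=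
  ⟨↑u⁻¹ * G, by rw [hI, Ideal.span_singleton_mul_left_unit (u⁻¹).isUnit],
    by rw [map_mul, hG, ← mul_assoc, ← map_mul, Units.inv_mul, map_one, one_mul]⟩

/-! ### 2. Hypothesis dictionary: the normalised cyclotomic generator over `K` and over `ℚ`;
(Heeg) ⇒ `(N, d_K) = 1` -/

section Dictionary

variable (K : Type) [Field K] [NumberField K] (p : ℕ) [Fact p.Prime]

/-- **The two spellings of "`γ` matches the cyclotomic variable" agree**: for `γ ∈ Γ_K`, the restriction
`γ|_{ℚ̄} ∈ Γ_ℚ` matches the cyclotomic variable of `padicLFunction` (`IsCyclotomicVariable p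
(absGaloisRestrict ℚ K γ)`: `χ_p(γ|) · ζ = γ_cyc`, `ζ` torsion — the hypothesis of the Yan–Zhu facts and
the BSTW24 binders) iff `χ_p^K(γ) · ζ = γ_cyc` for a torsion `ζ` (the inline hypothesis of
`thm723_…`, `prop331_…`), because `χ_p` commutes with restriction (`cyclotomicCharacter_absGaloisRestrict`)
— the paper's "`Γ_K⁺` naturally identified with `Γ_ℚ`" (§2, l.697–714) at the level of generators.
[cite: CastellaGrossiSkinner2025, §2 (final TeX l.697–714: Γ_K⁺ ≃ Γ_ℚ, Λ_K⁺ = Λ_ℚ "naturally identified")]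
[cite: Washington1997, §13.1 (the cyclotomic ℤ_p-extension of a number field via χ_p)] -/
theorem isCyclotomicVariable_absGaloisRestrict_iff (γ : absoluteGaloisGroup K) :
    IsCyclotomicVariable p (absGaloisRestrict ℚ K γ) ↔
      ∃ ζ : ℤ_[p]ˣ, IsOfFinOrder ζ ∧
        ((GaloisRep.cyclotomicCharacter K p γ * ζ : ℤ_[p]ˣ) : ℤ_[p]) = (cyclotomicGenerator p : ℤ_[p]) := by
  haveI : NeZero (p : ℚ) := ⟨by exact_mod_cast (Fact.out : p.Prime).ne_zero⟩
  unfold IsCyclotomicVariable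
  rw [cyclotomicCharacter_absGaloisRestrict ℚ K p γ]

variable {K p}

/-- **(Heeg) ⇒ `(N, d_K) = 1`** in the `IsCoprime` spelling of the Yan–Zhu / BSTW24 statements (every
prime dividing `N` splits in `K`, hence is unramified: tree `SatisfiesHeegnerHypothesis.coprime_discr`).
[cite: CastellaGrossiSkinner2025, §2.2 (Heeg) (final TeX l.897) with §3 standing hypotheses (l.1104)]
[cite: GrossZagier1986, I.(3.1) (the standing hypothesis (D, N) = 1 implied by the Heegner hypothesis)] -/
theorem isCoprime_discr_of_satisfiesHeegnerHypothesis (hK : IsImaginaryQuadratic K) {N : ℕ}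
    (hH : SatisfiesHeegnerHypothesis N K) : IsCoprime (N : ℤ) (NumberField.discr K) := by
  refine Int.isCoprime_iff_gcd_eq_one.mpr ?_
  rw [Int.gcd_eq_natAbs, Int.natAbs_natCast]
  exact Literature.SatisfiesHeegnerHypothesis.coprime_discr hK.1 hH

end Dictionary

/-! ### 3. Theorem 7.2.3, literal display: `ch_{Λ_K⁺}(𝔛_ord(E/K_∞⁺)) = (𝓛_p^PR(E/K)⁺)` -/

section Literal

variable {p : ℕ} [Fact p.Prime] {K : Type} [Field K] [NumberField K]

/-- **Castella–Grossi–Skinner 2025, Theorem 7.2.3 — LITERAL printed display, per datum** (final TeX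
l.3422–3431): "`𝔛_ord(E/K_∞⁺)` is `Λ_K⁺`-torsion, with `ch_{Λ_K⁺}(𝔛_ord(E/K_∞⁺)) = (𝓛_p^PR(E/K)⁺)`",
`𝓛_p^PR(E/K)` of Def. 2.2.2 carried by `perrinRiouLFunction W π F` for `F` in Hida's frame
(`IsHidaRankinLFunction ι W κ₁ κ₂ π.f F`, = [CGS, Thm. 2.2.3]) and `(·)⁺ = cycRestrict`
(l.847), PROVED from the named facts `thm723_charIdeal_eq_padicLFunction_mul` (Thm. 7.2.3 read through
Prop. 2.2.4) and `YanZhu2026.prop37_cycRestrict_perrinRiou_eq_padicLFunction_mul` (Prop. 2.2.4 at print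
strength), the twist's newform being supplied by `nonempty_modularParametrizationData` (BCDT): the
auxiliary `ϖ, W', g, ϖ'` of the two facts are CHOSEN, the product display `ι G = ϖϖ' · L_p(f,α) · L_p(g,α')`
and `cycRestrict 𝓛_p^PR = ι(u) · ϖϖ' · L_p(f,α) · L_p(g,α')` are combined, and the unit `u` is absorbed
into the generator. Hypotheses: module docstring "Transcription" (`(E, p, K)` VERBATIM as in `thm723_…`;
THE cyc/anti pair with adapted generators, `γ₁|_{ℚ̄}` matching the cyclotomic variable; `π` at `N_E`).
[cite: CastellaGrossiSkinner2025, Thm. 7.2.3 (final TeX l.3422–3431; arXiv v1 Thm. 6.1.3), literal display, with Def. 2.2.2 (l.821–826) and l.847 (𝓛_p^PR(E/K)⁺); proof via Prop. 2.2.4 (l.849–856)]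
[cite: YanZhu2024MainConjNonCM, Prop. 3.7 and Def. 3.4 (arXiv:2412.20078v4 TeX l.821–829, l.757–763) — the named carrier and Prop. 2.2.4 at print strength] -/
theorem isTorsion_and_exists_charIdeal_eq_span_cycRestrict_perrinRiou_of_thm723
    (h723 : thm723_charIdeal_eq_padicLFunction_mul)
    (h37 : YanZhu2026.prop37_cycRestrict_perrinRiou_eq_padicLFunction_mul)
    (hmod : nonempty_modularParametrizationData)
    (ι : integralClosure ℚ ℂ →+* ℂ_[p]) (W : WeierstrassCurve ℚ) [W.IsElliptic] [W.IsGloballyMinimal]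
    (hp : 2 < p) (hgood : Good W p) (hred : Red W p) (hna : ¬ Anom W p) (hK : IsImaginaryQuadratic K)
    (hH : SatisfiesHeegnerHypothesis (W.conductorNorm ℤ) K) (hodd : Odd (discr K)) (h3 : discr K ≠ -3)
    (hsplit : ((Ideal.span {(p : ℤ)}).primesOver (𝓞 K)).ncard = 2)
    (κ₁ κ₂ : ZpExtension K p) (γ₁ γ₂ : absoluteGaloisGroup K)
    [hpair : Fact (ZpExtension.IsTopGeneratorPair κ₁ κ₂ γ₁ γ₂)]
    (hκ₁ : κ₁.IsCyclotomic) (hκ₂ : κ₂.IsAnticyclotomic)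
    (hγ₁ : IsCyclotomicVariable p (absGaloisRestrict ℚ K γ₁))
    {N : ℕ} [NeZero N] (π : ModularParametrizationData W N) (hN : (N : ℤ) = W.conductorNorm ℤ)
    {F : CycAntiSeries p} (hF : IsHidaRankinLFunction ι W κ₁ κ₂ π.f F)
    (D : (W.baseChange K).SelmerDualData κ₁ γ₁) :
    D.IsTorsion ∧ ∃ G : IwasawaAlgebra p, D.charIdeal = Ideal.span {G} ∧
      iwasawaToPowerSeries p G = cycRestrict (perrinRiouLFunction W π F) := by
  obtain rfl : N = W.conductorNorm ℤ := by exact_mod_cast hN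
  have hp3 : 3 ≤ p := by omega
  -- the `K`-side normalisation of `γ₁` and its generator property
  have hγ₁K := (isCyclotomicVariable_absGaloisRestrict_iff K p γ₁).mp hγ₁
  have hgen : κ₁.IsTopGenerator γ₁ := hpair.out.left
  -- `(N, d_K) = 1` from (Heeg)
  have hcop : IsCoprime ((W.conductorNorm ℤ : ℕ) : ℤ) (NumberField.discr K) :=
    isCoprime_discr_of_satisfiesHeegnerHypothesis hK hH
  -- the period ratio `ϖ` of `π.f`
  obtain ⟨ϖ, -, hϖ, -⟩ := π.exists_rat_mul_realPeriodRat_eq_plusPeriod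
  -- the twist `E^K`: a minimal model `W'`, its parametrisation at the conductor (BCDT), its `ϖ'`
  have hd0 : (discr K : ℚ) ≠ 0 := by exact_mod_cast (IsImaginaryQuadratic.discr_neg hK).ne
  obtain ⟨W', hE', hM', C, hC⟩ := exists_isGloballyMinimal_smul_eq_quadraticTwist W hd0
  have hW' : ∃ C : VariableChange ℚ, C • W' = W.quadraticTwist (discr K : ℚ) := ⟨C, hC⟩
  haveI : NeZero (W'.conductorNorm ℤ) := ⟨(W'.conductorNorm_pos_holds).ne'⟩
  obtain ⟨M'⟩ := hmod W'
  obtain ⟨ϖ', -, hϖ', -⟩ := M'.exists_rat_mul_realPeriodRat_eq_plusPeriod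
  -- Thm. 7.2.3 (product display) and Prop. 2.2.4 at print strength
  obtain ⟨htors, G, hG, hιG⟩ := h723 W p hp hgood hred hna K hK hH hodd h3 hsplit κ₁ γ₁ hκ₁ hgen hγ₁K
    π.f π.isNewformOf ϖ hϖ W' hW' M'.f M'.isNewformOf ϖ' hϖ' D
  obtain ⟨u, hu⟩ := h37 ι W K κ₁ κ₂ γ₁ γ₂ π ϖ W' M'.f ϖ' hp3
    (goodOrd_of_red_of_good W p hp hgood hred) hK hsplit hcop hκ₁ hκ₂ hγ₁ hϖ hW' M'.isNewformOf hϖ' F hF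
  exact ⟨htors, exists_eq_span_and_map_eq_of_eq_map_unit_mul (iwasawaToPowerSeries p) hG hιG u hu⟩

/-- **Castella–Grossi–Skinner 2025, Theorem 7.2.3 — LITERAL printed display, in the shape of the
cyclotomic clause of statement 9.10 of BSTW24** (the `· = cyc` conjunct of
`BurungaleSkinnerTianWan2024.thm1010b_standardMainStatement_oneVariable_OPEN`, an UNREFEREED claim on the
(irr_ℚ)-locus): on the EISENSTEIN locus of the refereed paper (`E[p]` reducible, `p > 2` good and
non-anomalous, `K` with (Heeg), (spl), (disc)), for THE cyclotomic/anticyclotomic pair with a normalised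
`γ₁` and `π` at the conductor — every dual datum `X` of `Sel_{p^∞}(E/K_∞⁺)` is `Λ`-torsion and, for every
`F` in Hida's frame, `char_Λ X = (G)` with `ι G = cycRestrict (𝓛_p^PR(E/K))`. PROVED from the named facts
listed (previous theorem); the torsion clause needs no `F`.
[cite: CastellaGrossiSkinner2025, Thm. 7.2.3 (final TeX l.3422–3431; arXiv v1 Thm. 6.1.3), literal display = Conj. 3.2.2 first line (l.1187–1194) PROVED; Def. 2.2.2, Prop. 2.2.4] -/
theorem forall_selmerDualData_isTorsion_and_charIdeal_eq_span_cycRestrict_perrinRiou_of_thm723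
    (h723 : thm723_charIdeal_eq_padicLFunction_mul)
    (h37 : YanZhu2026.prop37_cycRestrict_perrinRiou_eq_padicLFunction_mul)
    (hmod : nonempty_modularParametrizationData)
    (ι : integralClosure ℚ ℂ →+* ℂ_[p]) (W : WeierstrassCurve ℚ) [W.IsElliptic] [W.IsGloballyMinimal]
    (hp : 2 < p) (hgood : Good W p) (hred : Red W p) (hna : ¬ Anom W p) (hK : IsImaginaryQuadratic K)
    (hH : SatisfiesHeegnerHypothesis (W.conductorNorm ℤ) K) (hodd : Odd (discr K)) (h3 : discr K ≠ -3)
    (hsplit : ((Ideal.span {(p : ℤ)}).primesOver (𝓞 K)).ncard = 2)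
    (κ₁ κ₂ : ZpExtension K p) (γ₁ γ₂ : absoluteGaloisGroup K)
    [Fact (ZpExtension.IsTopGeneratorPair κ₁ κ₂ γ₁ γ₂)]
    (hκ₁ : κ₁.IsCyclotomic) (hκ₂ : κ₂.IsAnticyclotomic)
    (hγ₁ : IsCyclotomicVariable p (absGaloisRestrict ℚ K γ₁))
    {N : ℕ} [NeZero N] (π : ModularParametrizationData W N) (hN : (N : ℤ) = W.conductorNorm ℤ) :
    ∀ X : (W.baseChange K).SelmerDualData κ₁ γ₁,
      X.IsTorsion ∧
        ∀ F : CycAntiSeries p, IsHidaRankinLFunction ι W κ₁ κ₂ π.f F →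
          ∃ G : IwasawaAlgebra p, X.charIdeal = Ideal.span {G} ∧
            iwasawaToPowerSeries p G = cycRestrict (perrinRiouLFunction W π F) := by
  intro X
  refine ⟨?_, fun F hF ↦ (isTorsion_and_exists_charIdeal_eq_span_cycRestrict_perrinRiou_of_thm723 h723
    h37 hmod ι W hp hgood hred hna hK hH hodd h3 hsplit κ₁ κ₂ γ₁ γ₂ hκ₁ hκ₂ hγ₁ π hN hF X).2⟩
  -- torsion: Thm. 7.2.3 as typed, at the chosen auxiliary data (no `F` needed)
  obtain rfl : N = W.conductorNorm ℤ := by exact_mod_cast hN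
  have hγ₁K := (isCyclotomicVariable_absGaloisRestrict_iff K p γ₁).mp hγ₁
  have hgen : κ₁.IsTopGenerator γ₁ :=
    (Fact.out : ZpExtension.IsTopGeneratorPair κ₁ κ₂ γ₁ γ₂).left
  obtain ⟨ϖ, -, hϖ, -⟩ := π.exists_rat_mul_realPeriodRat_eq_plusPeriod
  have hd0 : (discr K : ℚ) ≠ 0 := by exact_mod_cast (IsImaginaryQuadratic.discr_neg hK).ne
  obtain ⟨W', hE', hM', C, hC⟩ := exists_isGloballyMinimal_smul_eq_quadraticTwist W hd0
  have hW' : ∃ C : VariableChange ℚ, C • W' = W.quadraticTwist (discr K : ℚ) := ⟨C, hC⟩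
  haveI : NeZero (W'.conductorNorm ℤ) := ⟨(W'.conductorNorm_pos_holds).ne'⟩
  obtain ⟨M'⟩ := hmod W'
  obtain ⟨ϖ', -, hϖ', -⟩ := M'.exists_rat_mul_realPeriodRat_eq_plusPeriod
  exact (h723 W p hp hgood hred hna K hK hH hodd h3 hsplit κ₁ γ₁ hκ₁ hgen hγ₁K π.f π.isNewformOf ϖ hϖ
    W' hW' M'.f M'.isNewformOf ϖ' hϖ' X).1

/-- **Theorem A + Prop. 3.3.1 + Prop. 2.2.4 ⇒ Theorem 7.2.3, literal display** — the same conclusion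
with Theorem A (`thmA_charIdeal_eq_padicLFunction`, A142) and Prop. 3.3.1 (`prop331_nonempty_linearEquiv_
prod`, the Shapiro descent) in place of the fact `thm723_…` (sibling `thm723_of_thmA`): the literal `K`-side
main conjecture over `K_∞⁺` at a good non-anomalous Eisenstein prime is DERIVED from the `ℚ`-side
Theorem A for `E` and `E^K`, all inputs refereed.
[cite: CastellaGrossiSkinner2025, Thm. 7.2.3 (final TeX l.3422–3431) from Thm. 7.1.1 = Theorem A, Prop. 3.3.1 (l.1271–1283) and Prop. 2.2.4 (l.849–856)] -/
theorem forall_selmerDualData_isTorsion_and_charIdeal_eq_span_cycRestrict_perrinRiou_of_thmA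
    (hA : thmA_charIdeal_eq_padicLFunction) (h331 : prop331_nonempty_linearEquiv_prod)
    (h37 : YanZhu2026.prop37_cycRestrict_perrinRiou_eq_padicLFunction_mul)
    (hmod : nonempty_modularParametrizationData)
    (ι : integralClosure ℚ ℂ →+* ℂ_[p]) (W : WeierstrassCurve ℚ) [W.IsElliptic] [W.IsGloballyMinimal]
    (hp : 2 < p) (hgood : Good W p) (hred : Red W p) (hna : ¬ Anom W p) (hK : IsImaginaryQuadratic K)
    (hH : SatisfiesHeegnerHypothesis (W.conductorNorm ℤ) K) (hodd : Odd (discr K)) (h3 : discr K ≠ -3)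
    (hsplit : ((Ideal.span {(p : ℤ)}).primesOver (𝓞 K)).ncard = 2)
    (κ₁ κ₂ : ZpExtension K p) (γ₁ γ₂ : absoluteGaloisGroup K)
    [Fact (ZpExtension.IsTopGeneratorPair κ₁ κ₂ γ₁ γ₂)]
    (hκ₁ : κ₁.IsCyclotomic) (hκ₂ : κ₂.IsAnticyclotomic)
    (hγ₁ : IsCyclotomicVariable p (absGaloisRestrict ℚ K γ₁))
    {N : ℕ} [NeZero N] (π : ModularParametrizationData W N) (hN : (N : ℤ) = W.conductorNorm ℤ) :
    ∀ X : (W.baseChange K).SelmerDualData κ₁ γ₁,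
      X.IsTorsion ∧
        ∀ F : CycAntiSeries p, IsHidaRankinLFunction ι W κ₁ κ₂ π.f F →
          ∃ G : IwasawaAlgebra p, X.charIdeal = Ideal.span {G} ∧
            iwasawaToPowerSeries p G = cycRestrict (perrinRiouLFunction W π F) :=
  forall_selmerDualData_isTorsion_and_charIdeal_eq_span_cycRestrict_perrinRiou_of_thm723
    (thm723_of_thmA hA h331) h37 hmod ι W hp hgood hred hna hK hH hodd h3 hsplit κ₁ κ₂ γ₁ γ₂ hκ₁ hκ₂ hγ₁
    π hN

/-- **`𝓛_p^PR(E/K)⁺ ∈ Λ_ℚ` on the Eisenstein locus** (l.847, "`𝓛_p^PR(E/K)⁺ ∈ Λ_ℚ`"), a corollary of the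
literal display: `cycRestrict (𝓛_p^PR(E/K))` is the image under `ι : Λ ↪ ℚ_p⟦S⟧` of an element of `Λ`
(namely a generator of the characteristic ideal of the tree's own dual datum `selmerDualData`).
Conditional on the same named facts; integrality of the TWO-variable `𝓛_p^PR(E/K)` is not claimed here.
[cite: CastellaGrossiSkinner2025, §2.2 (final TeX l.847: 𝓛_p^PR(E/K)⁺ ∈ Λ_ℚ) with Thm. 7.2.3 (l.3422–3431)] -/
theorem exists_iwasawaToPowerSeries_eq_cycRestrict_perrinRiou_of_thm723
    (h723 : thm723_charIdeal_eq_padicLFunction_mul)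
    (h37 : YanZhu2026.prop37_cycRestrict_perrinRiou_eq_padicLFunction_mul)
    (hmod : nonempty_modularParametrizationData)
    (ι : integralClosure ℚ ℂ →+* ℂ_[p]) (W : WeierstrassCurve ℚ) [W.IsElliptic] [W.IsGloballyMinimal]
    (hp : 2 < p) (hgood : Good W p) (hred : Red W p) (hna : ¬ Anom W p) (hK : IsImaginaryQuadratic K)
    (hH : SatisfiesHeegnerHypothesis (W.conductorNorm ℤ) K) (hodd : Odd (discr K)) (h3 : discr K ≠ -3)
    (hsplit : ((Ideal.span {(p : ℤ)}).primesOver (𝓞 K)).ncard = 2)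
    (κ₁ κ₂ : ZpExtension K p) (γ₁ γ₂ : absoluteGaloisGroup K)
    [Fact (ZpExtension.IsTopGeneratorPair κ₁ κ₂ γ₁ γ₂)]
    (hκ₁ : κ₁.IsCyclotomic) (hκ₂ : κ₂.IsAnticyclotomic)
    (hγ₁ : IsCyclotomicVariable p (absGaloisRestrict ℚ K γ₁))
    {N : ℕ} [NeZero N] (π : ModularParametrizationData W N) (hN : (N : ℤ) = W.conductorNorm ℤ)
    {F : CycAntiSeries p} (hF : IsHidaRankinLFunction ι W κ₁ κ₂ π.f F) :
    ∃ G : IwasawaAlgebra p,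
      iwasawaToPowerSeries p G = cycRestrict (perrinRiouLFunction W π F) := by
  have hgen : κ₁.IsTopGenerator γ₁ :=
    (Fact.out : ZpExtension.IsTopGeneratorPair κ₁ κ₂ γ₁ γ₂).left
  obtain ⟨-, G, -, hG⟩ := isTorsion_and_exists_charIdeal_eq_span_cycRestrict_perrinRiou_of_thm723 h723
    h37 hmod ι W hp hgood hred hna hK hH hodd h3 hsplit κ₁ κ₂ γ₁ γ₂ hκ₁ hκ₂ hγ₁ π hN hF
    ((W.baseChange K).selmerDualData κ₁ hgen)
  exact ⟨G, hG⟩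

end Literal

/-! ### 4. Conversely (pointwise): the literal display + Prop. 2.2.4 give back the product display -/

section Converse

variable {p : ℕ} [Fact p.Prime] {K : Type} [Field K] [NumberField K]

/-- **Literal display ⇒ product display, per datum** (the USE of Prop. 2.2.4 in the paper's reading of
Thm. 7.2.3, and in BSTW24 Lemma 9.17 (i)): under the hypotheses of
`YanZhu2026.prop37_cycRestrict_perrinRiou_eq_padicLFunction_mul`, if an ideal `I` of `Λ` (e.g. the
characteristic ideal of a dual datum of `𝔛_ord(E/K_∞⁺)`) is `(G)` with `ι G = cycRestrict (𝓛_p^PR(E/K))`,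
then `I = (G')` with `ι G' = ϖϖ' · L_p(f_E, α) · L_p(g, α')` — the right-hand side of `thm723_…`
VERBATIM (unit `u⁻¹` absorbed). Pure algebra over the named fact; in particular it upgrades any
`cycRestrict`-shaped cyclotomic clause (such as BSTW24's) to the product form with ONE unit and NO power
of `p`. [cite: CastellaGrossiSkinner2025, Prop. 2.2.4 (final TeX l.849–856) applied to Thm. 7.2.3 (l.3422–3431)]
[cite: YanZhu2024MainConjNonCM, Prop. 3.7 (arXiv:2412.20078v4 TeX l.821–829)] -/
theorem exists_eq_span_and_eq_padicLFunction_mul_of_eq_cycRestrict_perrinRiou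
    (h37 : YanZhu2026.prop37_cycRestrict_perrinRiou_eq_padicLFunction_mul)
    (ι : integralClosure ℚ ℂ →+* ℂ_[p]) (W : WeierstrassCurve ℚ) [W.IsElliptic] [W.IsGloballyMinimal]
    (κ₁ κ₂ : ZpExtension K p) (γ₁ γ₂ : absoluteGaloisGroup K)
    [Fact (ZpExtension.IsTopGeneratorPair κ₁ κ₂ γ₁ γ₂)]
    {N : ℕ} [NeZero N] (π : ModularParametrizationData W N) {ϖ : ℚ}
    (W' : WeierstrassCurve ℚ) [W'.IsElliptic] [W'.IsGloballyMinimal]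
    {N' : ℕ} [NeZero N'] {g : CuspForm (Gamma0 N') 2} {ϖ' : ℚ}
    (hp : 3 ≤ p) (hord : GoodOrd W p) (hK : IsImaginaryQuadratic K)
    (hsplit : ((Ideal.span {(p : ℤ)}).primesOver (𝓞 K)).ncard = 2)
    (hN : IsCoprime (N : ℤ) (NumberField.discr K)) (hκ₁ : κ₁.IsCyclotomic) (hκ₂ : κ₂.IsAnticyclotomic)
    (hγ₁ : IsCyclotomicVariable p (absGaloisRestrict ℚ K γ₁))
    (hϖ : (ϖ : ℝ) * W.realPeriodRat = plusPeriod π.f)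
    (hW' : ∃ C : VariableChange ℚ, C • W' = W.quadraticTwist (NumberField.discr K : ℚ))
    (hg : IsNewformOf W' g) (hϖ' : (ϖ' : ℝ) * W'.realPeriodRat = plusPeriod g)
    {F : CycAntiSeries p} (hF : IsHidaRankinLFunction ι W κ₁ κ₂ π.f F)
    {I : Ideal (IwasawaAlgebra p)} {G : IwasawaAlgebra p} (hI : I = Ideal.span {G})
    (hG : iwasawaToPowerSeries p G = cycRestrict (perrinRiouLFunction W π F)) :
    ∃ G' : IwasawaAlgebra p, I = Ideal.span {G'} ∧
      iwasawaToPowerSeries p G' =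
        PowerSeries.C ((ϖ * ϖ' : ℚ) : ℚ_[p]) *
          (padicLFunction π.f (unitRoot W p : ℚ_[p]) * padicLFunction g (unitRoot W' p : ℚ_[p])) := by
  obtain ⟨u, hu⟩ := h37 ι W K κ₁ κ₂ γ₁ γ₂ π ϖ W' g ϖ' hp hord hK hsplit hN hκ₁ hκ₂ hγ₁ hϖ hW' hg hϖ' F hF
  exact exists_eq_span_and_map_eq_of_map_eq_unit_mul (iwasawaToPowerSeries p) hI u (by rw [hG, hu])

/-- **Product display ⇒ literal display, per datum** (the direction used in §3, isolated as pure
algebra over the named fact): under the hypotheses of `prop37_…_mul`, if `I = (G)` with `ι G = ϖϖ' ·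
L_p(f_E, α) · L_p(g, α')`, then `I = (G')` with `ι G' = cycRestrict (𝓛_p^PR(E/K))`.
[cite: CastellaGrossiSkinner2025, Prop. 2.2.4 (final TeX l.849–856) applied to Thm. 7.2.3 (l.3422–3431)]
[cite: YanZhu2024MainConjNonCM, Prop. 3.7 (arXiv:2412.20078v4 TeX l.821–829)] -/
theorem exists_eq_span_and_eq_cycRestrict_perrinRiou_of_eq_padicLFunction_mul
    (h37 : YanZhu2026.prop37_cycRestrict_perrinRiou_eq_padicLFunction_mul)
    (ι : integralClosure ℚ ℂ →+* ℂ_[p]) (W : WeierstrassCurve ℚ) [W.IsElliptic] [W.IsGloballyMinimal]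
    (κ₁ κ₂ : ZpExtension K p) (γ₁ γ₂ : absoluteGaloisGroup K)
    [Fact (ZpExtension.IsTopGeneratorPair κ₁ κ₂ γ₁ γ₂)]
    {N : ℕ} [NeZero N] (π : ModularParametrizationData W N) {ϖ : ℚ}
    (W' : WeierstrassCurve ℚ) [W'.IsElliptic] [W'.IsGloballyMinimal]
    {N' : ℕ} [NeZero N'] {g : CuspForm (Gamma0 N') 2} {ϖ' : ℚ}
    (hp : 3 ≤ p) (hord : GoodOrd W p) (hK : IsImaginaryQuadratic K)
    (hsplit : ((Ideal.span {(p : ℤ)}).primesOver (𝓞 K)).ncard = 2)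
    (hN : IsCoprime (N : ℤ) (NumberField.discr K)) (hκ₁ : κ₁.IsCyclotomic) (hκ₂ : κ₂.IsAnticyclotomic)
    (hγ₁ : IsCyclotomicVariable p (absGaloisRestrict ℚ K γ₁))
    (hϖ : (ϖ : ℝ) * W.realPeriodRat = plusPeriod π.f)
    (hW' : ∃ C : VariableChange ℚ, C • W' = W.quadraticTwist (NumberField.discr K : ℚ))
    (hg : IsNewformOf W' g) (hϖ' : (ϖ' : ℝ) * W'.realPeriodRat = plusPeriod g)
    {F : CycAntiSeries p} (hF : IsHidaRankinLFunction ι W κ₁ κ₂ π.f F)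
    {I : Ideal (IwasawaAlgebra p)} {G : IwasawaAlgebra p} (hI : I = Ideal.span {G})
    (hG : iwasawaToPowerSeries p G =
      PowerSeries.C ((ϖ * ϖ' : ℚ) : ℚ_[p]) *
        (padicLFunction π.f (unitRoot W p : ℚ_[p]) * padicLFunction g (unitRoot W' p : ℚ_[p]))) :
    ∃ G' : IwasawaAlgebra p, I = Ideal.span {G'} ∧
      iwasawaToPowerSeries p G' = cycRestrict (perrinRiouLFunction W π F) := by
  obtain ⟨u, hu⟩ := h37 ι W K κ₁ κ₂ γ₁ γ₂ π ϖ W' g ϖ' hp hord hK hsplit hN hκ₁ hκ₂ hγ₁ hϖ hW' hg hϖ' F hF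
  exact exists_eq_span_and_map_eq_of_eq_map_unit_mul (iwasawaToPowerSeries p) hI hG u hu

end Converse

/-! ### 5. A REMOVABLE hypothesis (rev 2): the (disc)-clause `d_K ≠ −3` of §7.2's `K` — Theorem 7.2.3
in both displays for EVERY imaginary quadratic `K` with (Heeg), (spl) and `d_K` odd, via Theorem A

The printed Thm. 7.2.3 is stated for the `K` chosen at the start of §7.2 (l.3288: (Heeg), (spl), (disc) =
"`D_K` odd and `D_K ≠ −3`", l.901), and so is the fact `thm723_…`. The (disc)-clause `d_K ≠ −3` enters the
paper's OWN proof of 7.2.3 (Steps 1–3: anticyclotomic input Thm. 6.5.3 / [CGLS]) but NOT the converse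
road "Theorem A for `E` and `E^K` + Prop. 3.3.1" (the sibling's `thm723_of_thmA`; Theorem A has no `K`,
Prop. 3.3.1 has the §3 standing hypotheses only, l.1104: `p` odd good ordinary, (Heeg), (spl)); `d_K`
odd is kept (it makes `d_K` a square-free twist parameter prime to `p`: `twist_hypotheses`). Hence, in the
kernel and from refereed print only, Thm. 7.2.3 holds WITHOUT `d_K ≠ −3` — one answer to the typing
layer's per-paper question "which hypotheses does the source name that are removable" (ASSIGNMENTS row
02). Not a claim of the paper; a consequence of its Theorem A. -/

section DiscFree

variable {p : ℕ} [Fact p.Prime] {K : Type} [Field K] [NumberField K]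

/-- **Thm. 7.2.3, product display, WITHOUT `d_K ≠ −3`** — from Theorem A (`thmA_charIdeal_eq_
padicLFunction`, for `E` and for `E^K`, which is again good, Eisenstein, non-anomalous at `p`:
`twist_hypotheses`) and Prop. 3.3.1 (`charIdeal_eq_mul_of_prop331`) over the normalised cyclotomic pair of
`ℚ` (`CyclotomicZp.zpExtension`): binder for binder the conclusion of `thm723_charIdeal_eq_padicLFunction_
mul`, with the hypothesis `discr K ≠ -3` DELETED (the sibling's `thm723_of_thmA`, which never uses it,
re-run without the binder). [cite: CastellaGrossiSkinner2025, Thm. 7.2.3 (final TeX l.3422–3431) via Thm. 7.1.1 = Theorem A and Prop. 3.3.1 (l.1271–1283; §3 standing hypotheses l.1104, no (disc)); (disc) l.901, l.3288] -/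
theorem isTorsion_and_exists_charIdeal_eq_span_padicLFunction_mul_of_thmA
    (hA : thmA_charIdeal_eq_padicLFunction) (h331 : prop331_nonempty_linearEquiv_prod)
    (W : WeierstrassCurve ℚ) [W.IsElliptic] [W.IsGloballyMinimal]
    (hp : 2 < p) (hgood : Good W p) (hred : Red W p) (hna : ¬ Anom W p) (hK : IsImaginaryQuadratic K)
    (hH : SatisfiesHeegnerHypothesis (W.conductorNorm ℤ) K) (hodd : Odd (discr K))
    (hsplit : ((Ideal.span {(p : ℤ)}).primesOver (𝓞 K)).ncard = 2)
    (κ : ZpExtension K p) (γ : absoluteGaloisGroup K) (hκ : κ.IsCyclotomic) (hγ : κ.IsTopGenerator γ)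
    (hγ' : ∃ ζ : ℤ_[p]ˣ, IsOfFinOrder ζ ∧
      ((GaloisRep.cyclotomicCharacter K p γ * ζ : ℤ_[p]ˣ) : ℤ_[p]) = (cyclotomicGenerator p : ℤ_[p]))
    [NeZero (W.conductorNorm ℤ)] (f : CuspForm (Gamma0 (W.conductorNorm ℤ)) 2) (hf : IsNewformOf W f)
    (ϖ : ℚ) (hϖ : (ϖ : ℝ) * W.realPeriodRat = plusPeriod f)
    (W' : WeierstrassCurve ℚ) [W'.IsElliptic] [W'.IsGloballyMinimal]
    (hW' : ∃ C : VariableChange ℚ, C • W' = W.quadraticTwist (discr K : ℚ))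
    [NeZero (W'.conductorNorm ℤ)] (g : CuspForm (Gamma0 (W'.conductorNorm ℤ)) 2)
    (hg : IsNewformOf W' g) (ϖ' : ℚ) (hϖ' : (ϖ' : ℝ) * W'.realPeriodRat = plusPeriod g)
    (D : (W.baseChange K).SelmerDualData κ γ) :
    D.IsTorsion ∧ ∃ G : IwasawaAlgebra p, D.charIdeal = Ideal.span {G} ∧
      iwasawaToPowerSeries p G =
        PowerSeries.C ((ϖ * ϖ' : ℚ) : ℚ_[p]) *
          (padicLFunction f (unitRoot W p : ℚ_[p]) * padicLFunction g (unitRoot W' p : ℚ_[p])) := by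
  have hp2 : p ≠ 2 := by omega
  obtain ⟨-, hgood', hred', hna', -⟩ := twist_hypotheses hp hgood hred hna hK hodd hsplit hW'
  -- the normalised cyclotomic pair over `ℚ` and the two dual data over `ℚ_∞`
  obtain ⟨γ₀, hγ₀, hχ⟩ := CyclotomicZp.exists_isTopGenerator_zpExtension p
  have hκ₀ : (CyclotomicZp.zpExtension p).IsCyclotomic := CyclotomicZp.isCyclotomic_zpExtension p
  have hγ₀' : IsCyclotomicVariable p γ₀ := ⟨1, IsOfFinOrder.one, by rw [mul_one]; exact hχ⟩
  let D₀ : W.SelmerDualData (CyclotomicZp.zpExtension p) γ₀ := W.selmerDualData _ hγ₀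
  let D₀' : W'.SelmerDualData (CyclotomicZp.zpExtension p) γ₀ := W'.selmerDualData _ hγ₀
  -- Theorem A for `E` and for `E^K`, Prop. 3.3.1
  obtain ⟨hDt, g₁, hg₁, hι₁⟩ := hA W p hp hgood hred hna _ γ₀ hκ₀ hγ₀ hγ₀' f hf ϖ hϖ D₀
  obtain ⟨hD't, g₂, hg₂, hι₂⟩ := hA W' p hp hgood' hred' hna' _ γ₀ hκ₀ hγ₀ hγ₀' g hg ϖ' hϖ' D₀'
  obtain ⟨hDKt, hchar⟩ := charIdeal_eq_mul_of_prop331 h331 W p hp2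
    (goodOrd_of_red_of_good W p hp hgood hred) K hK hH hsplit W' hW' κ γ _ γ₀ hκ hγ hγ' hκ₀ hγ₀ hγ₀' D
    D₀ D₀' hDt hD't
  refine ⟨hDKt, g₁ * g₂, ?_, ?_⟩
  · rw [hchar, hg₁, hg₂, Ideal.span_singleton_mul_span_singleton]
  · rw [map_mul, hι₁, hι₂, Rat.cast_mul, map_mul]
    ring

/-- **Thm. 7.2.3, LITERAL display, WITHOUT `d_K ≠ −3`** — `𝔛_ord(E/K_∞⁺)` torsion and `char = (G)`,
`ι G = cycRestrict (𝓛_p^PR(E/K))`, for EVERY imaginary quadratic `K` with (Heeg), (spl) and `d_K` odd, at a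
good non-anomalous Eisenstein `p > 2`: the previous theorem combined with Prop. 2.2.4 at print strength and
BCDT exactly as in §3. Derived from refereed print (Theorem A, Prop. 3.3.1, Prop. 2.2.4); the paper states
7.2.3 only for its §7.2 `K` (with `d_K ≠ −3`). [cite: CastellaGrossiSkinner2025, Thm. 7.2.3 literal display (final TeX l.3422–3431) via Theorem A, Prop. 3.3.1 (l.1271–1283) and Prop. 2.2.4 (l.849–856); (disc) l.901, l.3288]
[cite: YanZhu2024MainConjNonCM, Prop. 3.7 and Def. 3.4 (arXiv:2412.20078v4 TeX l.821–829, l.757–763)] -/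
theorem isTorsion_and_exists_charIdeal_eq_span_cycRestrict_perrinRiou_of_thmA
    (hA : thmA_charIdeal_eq_padicLFunction) (h331 : prop331_nonempty_linearEquiv_prod)
    (h37 : YanZhu2026.prop37_cycRestrict_perrinRiou_eq_padicLFunction_mul)
    (hmod : nonempty_modularParametrizationData)
    (ι : integralClosure ℚ ℂ →+* ℂ_[p]) (W : WeierstrassCurve ℚ) [W.IsElliptic] [W.IsGloballyMinimal]
    (hp : 2 < p) (hgood : Good W p) (hred : Red W p) (hna : ¬ Anom W p) (hK : IsImaginaryQuadratic K)
    (hH : SatisfiesHeegnerHypothesis (W.conductorNorm ℤ) K) (hodd : Odd (discr K))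
    (hsplit : ((Ideal.span {(p : ℤ)}).primesOver (𝓞 K)).ncard = 2)
    (κ₁ κ₂ : ZpExtension K p) (γ₁ γ₂ : absoluteGaloisGroup K)
    [hpair : Fact (ZpExtension.IsTopGeneratorPair κ₁ κ₂ γ₁ γ₂)]
    (hκ₁ : κ₁.IsCyclotomic) (hκ₂ : κ₂.IsAnticyclotomic)
    (hγ₁ : IsCyclotomicVariable p (absGaloisRestrict ℚ K γ₁))
    {N : ℕ} [NeZero N] (π : ModularParametrizationData W N) (hN : (N : ℤ) = W.conductorNorm ℤ)
    {F : CycAntiSeries p} (hF : IsHidaRankinLFunction ι W κ₁ κ₂ π.f F)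
    (D : (W.baseChange K).SelmerDualData κ₁ γ₁) :
    D.IsTorsion ∧ ∃ G : IwasawaAlgebra p, D.charIdeal = Ideal.span {G} ∧
      iwasawaToPowerSeries p G = cycRestrict (perrinRiouLFunction W π F) := by
  obtain rfl : N = W.conductorNorm ℤ := by exact_mod_cast hN
  have hp3 : 3 ≤ p := by omega
  have hγ₁K := (isCyclotomicVariable_absGaloisRestrict_iff K p γ₁).mp hγ₁
  have hgen : κ₁.IsTopGenerator γ₁ := hpair.out.left
  have hcop : IsCoprime ((W.conductorNorm ℤ : ℕ) : ℤ) (NumberField.discr K) :=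
    isCoprime_discr_of_satisfiesHeegnerHypothesis hK hH
  obtain ⟨ϖ, -, hϖ, -⟩ := π.exists_rat_mul_realPeriodRat_eq_plusPeriod
  have hd0 : (discr K : ℚ) ≠ 0 := by exact_mod_cast (IsImaginaryQuadratic.discr_neg hK).ne
  obtain ⟨W', hE', hM', C, hC⟩ := exists_isGloballyMinimal_smul_eq_quadraticTwist W hd0
  have hW' : ∃ C : VariableChange ℚ, C • W' = W.quadraticTwist (discr K : ℚ) := ⟨C, hC⟩
  haveI : NeZero (W'.conductorNorm ℤ) := ⟨(W'.conductorNorm_pos_holds).ne'⟩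
  obtain ⟨M'⟩ := hmod W'
  obtain ⟨ϖ', -, hϖ', -⟩ := M'.exists_rat_mul_realPeriodRat_eq_plusPeriod
  obtain ⟨htors, G, hG, hιG⟩ := isTorsion_and_exists_charIdeal_eq_span_padicLFunction_mul_of_thmA hA
    h331 W hp hgood hred hna hK hH hodd hsplit κ₁ γ₁ hκ₁ hgen hγ₁K π.f π.isNewformOf ϖ hϖ W' hW' M'.f
    M'.isNewformOf ϖ' hϖ' D
  obtain ⟨u, hu⟩ := h37 ι W K κ₁ κ₂ γ₁ γ₂ π ϖ W' M'.f ϖ' hp3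
    (goodOrd_of_red_of_good W p hp hgood hred) hK hsplit hcop hκ₁ hκ₂ hγ₁ hϖ hW' M'.isNewformOf hϖ' F hF
  exact ⟨htors, exists_eq_span_and_map_eq_of_eq_map_unit_mul (iwasawaToPowerSeries p) hG hιG u hu⟩

end DiscFree

end Literature.NumberTheory.EllipticCurves.CastellaGrossiSkinner2025

end
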